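import Summits.QuantumFields.BalabanUV.Beta.GAN24.BornBorderContactBound

/-!
# `BalabanUV.Beta.GAN24.BornBorderContactPairTent` — binder row G-an2-4 / (CONV-C), CT-ROUTE, «(V-C)-DIFF» module (D⁰): **THE TENT PAIRS OF THE COMPOSITE MULTIPLIER LEGS** (generic `d`,
# PARAMETRIC in the K-slot's all-scales letter `hKall : CauchyDecayK d Lc (sfStep Lc) (smStep d Lc) cK θ δ`) — the composite multiplier legs of the births `i+1` and `i` at the SAME relative
# depth `n`, read at the packed sites, differ by `cK·θ^{i+n}·e^{δ}·((Lc^n)^{2d+1})⁻¹·e^{−δ‖quo (Lc^n) y − z′‖∞}`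

NOT IN PRINT; OUR BOOKKEEPING (G-an2-4 formalisation swarm → CRUX TEAM (2), leaf prover `b2b-balaban-gan24-formalise-leaf-03`, gen 56; «(V-C)-DIFF» INTENT journal `CLAIMS.log`
[LEAF03-G56-ONLINE] ∕ [LEAF03-G56-A1]).  [folklore] units arithmetic over gan24-p2 g32's CT-4d `ContactTentCauchy.abs_unitTent_sub_le`, (D⁻) `BornBorderContactBound` §1
(`legComp_colM∕rowMM_KStepUnit_respStep`: both legs are `s²•tentLeg`; `tentLeg_zsmul`), leaf-01 g61's `BornLambdaBracketPair` φ-trick (the difference of the two unit tents is ONE tent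
of the unit-kernel difference: `BornLambdaTent.contourSumAdj_const_mul`, p2's `ContactTentRefine.contourSumAdj_sub ∕ abs_contourSumAdj_le_centre`, `BornLambdaBracketLetter.wΦ_congrN`)
BY NAME.  Generic `d`; 0 `def`, 0 cited facts, 0 `def … : Prop`, 0 sorry; NO estimate of Bałaban's (the K-slot letter is a HYPOTHESIS; at `d = 3` it is `KSlotAssembly.convCKWall_holds`,
plugged in (D) `BornBorderContactPairBound`).  HONEST FRAMING (cell contract, verbatim): «discharging `BetaPertH` makes Bałaban's UV stability UNCONDITIONAL — a real milestone — but is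
NOT existence of continuum YM on T⁴ and NOT the Clay problem.»  Discharges nothing: NOT hBdev, NOT (hS, hSall), NEVER «G-an2-4 closed», NOT (CONV-C), NOT D1, NOT `BetaPertH`.  HONEST
DEPENDENCY: continuum YM on T⁴ ⇐ BetaPertH ∧ nine spine estimates (0/9 proved); BetaPertH ⇐ (D1) ∧ (D4) ∧ CAP+tail; G-an2-4 gates asym, D1 and NE2/3/4.

WHAT IS PROVED: `abs_unitColumn_sub_le` (the unit columns of consecutive births: `((Lc^{m+1})^{2(d+1)})⁻¹ ×` CT-4d's unit-tent pair), `abs_unitColumnTent_sub_le` (their `𝒬ᵀ_{Lc^m}` tents),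
**`abs_legComp_colM_zsmul_sub_le ∕ abs_legComp_rowMM_zsmul_sub_le`** (the composite `mm`-column ∕ `mm`-row legs of `K̃_{i+1}` against `K̃_i` at the packed sites).
-/

open Literature.MathematicalPhysics.QuantumFieldTheory
open Literature.MathematicalPhysics.QuantumFieldTheory.LatticeForm (quo)
open Literature.MathematicalPhysics.QuantumFieldTheory.Balaban1983to89
open Literature.MathematicalPhysics.QuantumFieldTheory.Balaban1983to89.Beta
open B4ContourShift (supNorm supNorm_nonneg)
open B12Sec2to5 (l1 l1_nonneg)
open AffineAveraging (Form1 Site)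
open AffineReproduction (contourSumAdj)
open KernelSpecInstance (wΦ)
open BalabanCompositeJets (respStep)
open Summit.QuantumFields.BalabanUV.Beta.GAN24.CombesThomas (sfStep smStep KStepUnit CauchyDecayK)
open Summit.QuantumFields.BalabanUV.Beta.GAN24.Push4 (legComp)
open Summit.QuantumFields.BalabanUV.Beta.GAN24.SrecLinearPartEq (colM rowMM)
open Summit.QuantumFields.BalabanUV.Beta.GAN24.RespStepCauchy (supNorm_le_l1)
open Summit.QuantumFields.BalabanUV.Beta.GAN24.ContactTentRefine (abs_contourSumAdj_le_centre contourSumAdj_sub)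
open Summit.QuantumFields.BalabanUV.Beta.GAN24.ContactTentCauchy (abs_unitTent_sub_le)
open Summit.QuantumFields.BalabanUV.Beta.GAN24.BornLambdaTent (contourSumAdj_const_mul)
open Summit.QuantumFields.BalabanUV.Beta.GAN24.BornLambdaBracketLetter (wΦ_congrN)
open Summit.QuantumFields.BalabanUV.Beta.GAN24.BornBorderTent (tentLeg tentLeg_zsmul)
open Summit.QuantumFields.BalabanUV.Beta.GAN24.BornBorderContactBound (legComp_colM_KStepUnit_respStep legComp_rowMM_KStepUnit_respStep)

namespace Summit.QuantumFields.BalabanUV.Beta.GAN24.BornBorderContactPairTent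

section Tent

variable {d : ℕ} {Lc : ℕ} [NeZero Lc]

/-- NOT IN PRINT; OUR BOOKKEEPING ([folklore]; the arithmetic of units over CT-4d's `abs_unitTent_sub_le`).  **THE UNIT COLUMNS OF CONSECUTIVE BIRTHS AT THE SAME RELATIVE DEPTH**:
from `hKall : CauchyDecayK … cK θ δ`, for all `i m κ l z`, `|(Lc^{i+1})^{2(d+1)}·wΦ_{Lc^{i+1+m+1}} κ l z − (Lc^i)^{2(d+1)}·wΦ_{Lc^{i+m+1}} κ l z| ≤ cK·θ^{i+m}·((Lc^m)^{2(d+1)})⁻¹·e^{−δ|z|₁}` — both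
columns are `((Lc^{m+1})^{2(d+1)})⁻¹ ×` the UNIT tents of levels `i+m+2`, `i+m+1`. -/
theorem abs_unitColumn_sub_le {cK θ δ : ℝ} (hKall : CauchyDecayK d Lc (sfStep Lc) (smStep d Lc) cK θ δ) (hδ : 0 ≤ δ) (i m : ℕ) (κ l : Fin (d + 1))
    (z : Site (d + 1)) :
    |(((Lc : ℝ) ^ (i + 1)) ^ (2 * (d + 1))) * wΦ (N := Lc ^ (i + 1 + m + 1)) (d := d) κ l z
        - (((Lc : ℝ) ^ i) ^ (2 * (d + 1))) * wΦ (N := Lc ^ (i + m + 1)) (d := d) κ l z|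
      ≤ cK * θ ^ (i + m) * ((((Lc : ℝ) ^ m) ^ (2 * (d + 1)))⁻¹) * Real.exp (-δ * l1 z) := by
  have hL : (0 : ℝ) < (Lc : ℝ) := Nat.cast_pos.2 (Nat.pos_of_ne_zero (NeZero.ne Lc))
  have h := abs_unitTent_sub_le hKall hδ (i + m) 1 κ l z
  set A : ℝ := (((Lc : ℝ) ^ (m + 1)) ^ (2 * (d + 1))) with hA
  have hA0 : 0 < A := by positivity
  have hp1 : ((Lc : ℝ) ^ (i + m + 1 + 1)) ^ (2 * (d + 1)) = A * ((Lc : ℝ) ^ (i + 1)) ^ (2 * (d + 1)) := by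
    rw [hA, ← mul_pow, ← pow_add]; congr 2; ring
  have hp2 : ((Lc : ℝ) ^ (i + m + 1)) ^ (2 * (d + 1)) = A * ((Lc : ℝ) ^ i) ^ (2 * (d + 1)) := by
    rw [hA, ← mul_pow, ← pow_add]; congr 2; ring
  have e : (((Lc : ℝ) ^ (i + 1)) ^ (2 * (d + 1))) * wΦ (N := Lc ^ (i + 1 + m + 1)) (d := d) κ l z
        - (((Lc : ℝ) ^ i) ^ (2 * (d + 1))) * wΦ (N := Lc ^ (i + m + 1)) (d := d) κ l z
      = A⁻¹ * ((((Lc : ℝ) ^ (i + m + 1 + 1)) ^ (2 * (d + 1))) * wΦ (N := Lc ^ (i + m + 1 + 1)) (d := d) κ l z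
          - (((Lc : ℝ) ^ (i + m + 1)) ^ (2 * (d + 1))) * wΦ (N := Lc ^ (i + m + 1)) (d := d) κ l z) := by
    rw [wΦ_congrN (show Lc ^ (i + 1 + m + 1) = Lc ^ (i + m + 1 + 1) by ring_nf) κ l z, hp1, hp2]
    field_simp
  rw [e, abs_mul, abs_inv, abs_of_pos hA0]
  refine (mul_le_mul_of_nonneg_left h (by positivity)).trans (le_of_eq ?_)
  have e2 : A = (Lc : ℝ) ^ (2 * (d + 1)) * (((Lc : ℝ) ^ m) ^ (2 * (d + 1))) := by
    rw [hA, ← mul_pow, ← pow_succ']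
  rw [e2]
  field_simp

/-- NOT IN PRINT; OUR BOOKKEEPING ([folklore]; leaf-01 g61's `BornLambdaBracketPair` φ-trick).  **THE TENTS OF CONSECUTIVE BIRTHS, POWER DISPLAYED**: from `hKall`, for all `i m κ′ μ u′ y`,
`|(Lc^{i+1})^{2(d+1)}·𝒬ᵀ_{Lc^m}[wΦ_{Lc^{i+1+m+1}}(·,κ′,·−u′)](μ,y) − (Lc^i)^{2(d+1)}·𝒬ᵀ_{Lc^m}[wΦ_{Lc^{i+m+1}}(·,κ′,·−u′)](μ,y)| ≤ cK·θ^{i+m}·e^{δ}·((Lc^m)^{2d+1})⁻¹·e^{−δ‖quo (Lc^m) y − u′‖∞}` — the two tents are ONE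
tent of the unit-column difference (`contourSumAdj_const_mul ∕ contourSumAdj_sub`), then p2's `abs_contourSumAdj_le_centre`. -/
theorem abs_unitColumnTent_sub_le {cK θ δ : ℝ} (hKall : CauchyDecayK d Lc (sfStep Lc) (smStep d Lc) cK θ δ) (hδ : 0 ≤ δ) (hcK : 0 ≤ cK) (hθ : 0 ≤ θ)
    (i m : ℕ) (κ' μ : Fin (d + 1)) (u' y : Site (d + 1)) :
    |(((Lc : ℝ) ^ (i + 1)) ^ (2 * (d + 1))) * contourSumAdj (Lc ^ m) (fun κ q => wΦ (N := Lc ^ (i + 1 + m + 1)) (d := d) κ κ' (q - u')) μ y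
        - (((Lc : ℝ) ^ i) ^ (2 * (d + 1))) * contourSumAdj (Lc ^ m) (fun κ q => wΦ (N := Lc ^ (i + m + 1)) (d := d) κ κ' (q - u')) μ y|
      ≤ cK * θ ^ (i + m) * Real.exp δ * ((((Lc : ℝ) ^ m) ^ (2 * d + 1))⁻¹) * Real.exp (-(δ * supNorm (quo (Lc ^ m) y - u'))) := by
  have hL : (0 : ℝ) < (Lc : ℝ) := Nat.cast_pos.2 (Nat.pos_of_ne_zero (NeZero.ne Lc))
  rw [← contourSumAdj_const_mul, ← contourSumAdj_const_mul, contourSumAdj_sub]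
  have hφ : ∀ κ q, |(((Lc : ℝ) ^ (i + 1)) ^ (2 * (d + 1))) * wΦ (N := Lc ^ (i + 1 + m + 1)) (d := d) κ κ' (q - u')
        - (((Lc : ℝ) ^ i) ^ (2 * (d + 1))) * wΦ (N := Lc ^ (i + m + 1)) (d := d) κ κ' (q - u')|
      ≤ cK * θ ^ (i + m) * ((((Lc : ℝ) ^ m) ^ (2 * (d + 1)))⁻¹) * Real.exp (-(δ * supNorm (q - u'))) := by
    intro κ q
    refine (abs_unitColumn_sub_le hKall hδ i m κ κ' (q - u')).trans (mul_le_mul_of_nonneg_left ?_ (by positivity))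
    rw [neg_mul]
    exact Real.exp_le_exp.2 (neg_le_neg (mul_le_mul_of_nonneg_left (supNorm_le_l1 _) hδ))
  refine (abs_contourSumAdj_le_centre (N := Lc ^ m) (by positivity) hδ u' hφ μ y).trans (le_of_eq ?_)
  have e : ((Lc : ℝ) ^ m) ^ (2 * (d + 1)) = ((Lc : ℝ) ^ m) ^ (2 * d + 1) * (Lc : ℝ) ^ m := by
    rw [show 2 * (d + 1) = (2 * d + 1) + 1 by ring, pow_succ]
  push_cast
  rw [e]
  field_simp

/-- NOT IN PRINT; OUR BOOKKEEPING ([folklore] over the K-slot).  **THE TENT PAIR OF THE COMPOSITE `mm`-COLUMN LEGS**: from `hKall`, for all `i n β z′ ν y`,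
`|legComp (colM K̃_{i+1} Lc) (respStep (Lc^(i+1+1)) (Lc^(i+1+n+1))) β z′ ν (Lc•y) − legComp (colM K̃_i Lc) (respStep (Lc^(i+1)) (Lc^(i+n+1))) β z′ ν (Lc•y)|`
`≤ cK·θ^{i+n}·e^{δ}·((Lc^n)^{2d+1})⁻¹·e^{−δ‖quo (Lc^n) y − z′‖∞}` — (D⁻) §1's closed form `s_i²•tentLeg`, `tentLeg_zsmul`, `s_i² = (Lc^i)^{2(d+1)}`, then `abs_unitColumnTent_sub_le`. -/
theorem abs_legComp_colM_zsmul_sub_le {cK θ δ : ℝ} (hKall : CauchyDecayK d Lc (sfStep Lc) (smStep d Lc) cK θ δ) (hδ : 0 ≤ δ) (hcK : 0 ≤ cK) (hθ : 0 ≤ θ)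
    (i n : ℕ) (β : Fin (d + 1)) (z' : Site (d + 1)) (ν : Fin (d + 1)) (y : Site (d + 1)) :
    |legComp (colM (KStepUnit (d := d) Lc (i + 1)) Lc) (respStep (d := d) (Lc ^ (i + 1 + 1)) (Lc ^ (i + 1 + n + 1))) β z' ν ((Lc : ℤ) • y)
        - legComp (colM (KStepUnit (d := d) Lc i) Lc) (respStep (d := d) (Lc ^ (i + 1)) (Lc ^ (i + n + 1))) β z' ν ((Lc : ℤ) • y)|
      ≤ cK * θ ^ (i + n) * Real.exp δ * ((((Lc : ℝ) ^ n) ^ (2 * d + 1))⁻¹) * Real.exp (-(δ * supNorm (quo (Lc ^ n) y - z'))) := by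
  rw [legComp_colM_KStepUnit_respStep, legComp_colM_KStepUnit_respStep]
  simp only [Pi.smul_apply, smul_eq_mul]
  rw [tentLeg_zsmul, tentLeg_zsmul, show smStep d Lc (i + 1) ^ 2 = ((Lc : ℝ) ^ (i + 1)) ^ (2 * (d + 1)) by
    rw [smStep, ← pow_mul, ← pow_mul]; congr 1; ring, show smStep d Lc i ^ 2 = ((Lc : ℝ) ^ i) ^ (2 * (d + 1)) by
    rw [smStep, ← pow_mul, ← pow_mul]; congr 1; ring]
  exact abs_unitColumnTent_sub_le hKall hδ hcK hθ i n β ν z' y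

/-- NOT IN PRINT; OUR BOOKKEEPING ([folklore] over the K-slot).  The same tent pair for the composite `mm`-ROW legs (left multiplier slot), centred at their own packed site. -/
theorem abs_legComp_rowMM_zsmul_sub_le {cK θ δ : ℝ} (hKall : CauchyDecayK d Lc (sfStep Lc) (smStep d Lc) cK θ δ) (hδ : 0 ≤ δ) (hcK : 0 ≤ cK) (hθ : 0 ≤ θ)
    (i n : ℕ) (α : Fin (d + 1)) (x' : Site (d + 1)) (μ : Fin (d + 1)) (y : Site (d + 1)) :
    |legComp (rowMM (KStepUnit (d := d) Lc (i + 1)) Lc) (respStep (d := d) (Lc ^ (i + 1 + 1)) (Lc ^ (i + 1 + n + 1))) α x' μ ((Lc : ℤ) • y)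
        - legComp (rowMM (KStepUnit (d := d) Lc i) Lc) (respStep (d := d) (Lc ^ (i + 1)) (Lc ^ (i + n + 1))) α x' μ ((Lc : ℤ) • y)|
      ≤ cK * θ ^ (i + n) * Real.exp δ * ((((Lc : ℝ) ^ n) ^ (2 * d + 1))⁻¹) * Real.exp (-(δ * supNorm (quo (Lc ^ n) y - x'))) := by
  rw [legComp_rowMM_KStepUnit_respStep, legComp_rowMM_KStepUnit_respStep]
  simp only [Pi.smul_apply, smul_eq_mul]
  rw [tentLeg_zsmul, tentLeg_zsmul, show smStep d Lc (i + 1) ^ 2 = ((Lc : ℝ) ^ (i + 1)) ^ (2 * (d + 1)) by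
    rw [smStep, ← pow_mul, ← pow_mul]; congr 1; ring, show smStep d Lc i ^ 2 = ((Lc : ℝ) ^ i) ^ (2 * (d + 1)) by
    rw [smStep, ← pow_mul, ← pow_mul]; congr 1; ring]
  exact abs_unitColumnTent_sub_le hKall hδ hcK hθ i n α μ x' y

end Tent

end Summit.QuantumFields.BalabanUV.Beta.GAN24.BornBorderContactPairTent
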